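import Summits.ABC.StewartYu.GenThreeInductionArchW
import Summits.ABC.StewartYu.GenThreeStepArch
import Summits.ABC.StewartYu.MatveevCramerMinor
import HarnessLib

/-!
# Cell abc-stewartyu, WP-L.A shell (parcel P-A1): the MATVEEV STEP at the archimedean place in the
# PIVOT-WEIGHTED currency — a Cramer minor THROUGH THE PIVOT, the step generators with their new pivot, and the
# step closed against the regime (2.6) and a PURELY NUMERIC record clause

`Summits/ABC/StewartYu/GenThreeStepArchW.lean` — cell `abc-stewartyu` (HOME `run/shared/lean/pub/abc-stewartyu/`),
route `YuMatveevShapeRat` (rung A1.L, crux r2 `ArchCoreRat`, stmt-ABC-20502), seat p4 (g9), parcel WP-L.A P-A1;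
the pivot-weighted sequel of `GenThreeStepArch.lean` (lit WP-LA-SPEC §17: in the unweighted currency the step's
cost line carries `log Ω`; in Matveev's currency it does not).  Theorems only; no definition, no named fact.

## The argument (Nesterenko 2003, Prop. 2.6 as corrected in SPEC §17.3; Matveev 2000 (1.3))

Datum at rank `n`: positive independent rationals `aⱼ`, weights `Aⱼ ≥ max(h(aⱼ),1)`, pivot `k₀` with
`b_{k₀} ≠ 0` and `|bⱼ|Aⱼ ≤ B·A_{k₀}`.  Exit C of the zero estimate: `H`, a `ℤ`-basis `M` of `H.chars` (`r` rows,
`0 < r < n`), `b ∈ span_ℚ M`.  `MatveevStepData.exists_matveev_step_data` (at `q = 1`) re-bases to `Z` with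
`∏ᵢ‖Zᵢ‖_A ≤ P(κ) := (r!)²nʳ·|det M_κ|·∏A_κ`.  Since `b_{k₀} ≠ 0` and `b ∈ span Z`, column `k₀` of `Z` is
non-zero, so (exchange lemma `exists_minor_through`) there is a non-singular `r × r` minor `κ′` of `Z` THROUGH
`k₀`, whence `∏A_{κ′} ≥ A_{k₀}`; Cramer on that minor (`exists_int_relation_weighted_of_minor`, the tree's
`LatticeLever.exists_int_relation_weighted` with the minor prescribed) gives `m₀ b = ∑ mᵢZᵢ`, `m₀ ≠ 0`,
`|m₀|·∏A_{κ′} ≤ ∏A′` and `|mⱼ|·∏A_{κ′} ≤ (∑_{κ′}Aₖ|bₖ|)·∏_{i≠j}A′ᵢ ≤ r·B·A_{k₀}·∏_{i≠j}A′ᵢ`.  New pivot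
`i₀` with `m_{i₀}·Z_{i₀k₀} ≠ 0` (a summand of `m₀b_{k₀} ≠ 0`), so `A′_{i₀} ≥ A_{k₀}`.  Hence
`|m₀| ≤ ∏A′/A_{k₀}`, `|mⱼ|A′ⱼ ≤ r·B·∏A′ =: B′·A′_{i₀}` with `B′ := r·B·∏A′/A′_{i₀} ≤ r·B·P/A_{k₀}`.  With the
regime (2.6) `C(n)·Ω·log(eB) < ∑Aⱼ|bⱼ| + log 2 < (n+1)·B·A_{k₀}` and a record bound `P(κ)·Y ≤ Ω`:
`P/A_{k₀} < (n+1)B/(Y·C(n))`, so `B′ < B²` and `|m₀| < B` as soon as `r(n+1) ≤ Y·C(n)`, and the cost line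
`C(r)·∏A′·log(eB′) + log|m₀| ≤ (2C(r)/Y + 1)·Ω·log(eB) ≤ C(n)·Ω·log(eB)` as soon as `2C(r) + Y ≤ Y·C(n)`.

## Contents

`exists_step_generators_archW` (the package above), `exists_bound_and_cost` (the numeric heart: `B′` and the
cost line, shared with the Kummer-carrying twin `GenThreeStepArchWK`), `stepArchW_of_exitC`; the linear algebra
(a non-singular
minor through the pivot column, Cramer on a given minor) is `MatveevCramerMinor.lean`
(`LatticeLever.exists_minor_through`, `LatticeLever.exists_int_relation_weighted_of_minor`).

WHAT THIS IS NOT: no analytic content; no crux moves.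

References: Yu. V. Nesterenko, LNM 1819 (2003), Prop. 2.6 (2.9)–(2.13) (pp. 57–58), §5.2 (5.21)–(5.22)
(pp. 105–106); E. M. Matveev, Izv. Math. 64 (2000), (1.3), Thm 2.1 (p. 127 of the Russian original).
-/

noncomputable section

open Finset
open Literature.NumberTheory.Transcendental
open Literature.NumberTheory.Transcendental.GaGm

namespace Summit.ABC.StewartYu.GenThreeStepArchW

open Summit.ABC.StewartYu.GenThreeInductionArch
open Summit.ABC.StewartYu.GenThreeInductionArchW
open Summit.ABC.StewartYu.GenThreeStepTwo (logHeight₁_prod_zpow_le one_le_weightedNorm le_prod_of_one_le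
  prod_erase_le_prod)
open Summit.ABC.StewartYu.LatticeLever (exists_minor_through exists_int_relation_weighted_of_minor)

variable {n r : ℕ}

/-! ### The step generators with their new pivot -/

/-- **The generators of Matveev's step at the archimedean place, pivot-weighted currency.**  From the exit-C datum
(`H`, a `ℤ`-basis `M` of `H.chars`, `b ∈ span_ℚ M`) over positive independent rationals `aⱼ` (`h(aⱼ) ≤ Aⱼ`,
`1 ≤ Aⱼ`) with pivot `b_{k₀} ≠ 0`: a re-based basis `Z` of `Φ`, generators `θᵢ = ∏ⱼ aⱼ^{Zᵢⱼ} > 0`, weights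
`A′ᵢ = ∑ⱼ Aⱼ|Zᵢⱼ| ≥ max(h(θᵢ),1)`, exponents `m` with the NEW PIVOT `i₀` (`m_{i₀} ≠ 0`, `Z_{i₀k₀} ≠ 0`), `m₀ ≠ 0`,
the relation `∏ θᵢ^{mᵢ} = (∏ aⱼ^{bⱼ})^{m₀}`, the size datum `∏A′ ≤ (r!)²nʳ·|det M_κ|·∏A_κ` (maximal
non-singular weighted minor `κ` of `M`), and the Cramer–Hadamard bounds on a non-singular minor `κ′` of `Z`
THROUGH `k₀`: `|m₀|·∏A_{κ′} ≤ ∏A′`, `|mⱼ|·∏A_{κ′} ≤ (∑ᵢ A_{κ′i}|b_{κ′i}|)·∏_{i≠j}A′ᵢ`; a `q`-Kummer clause on `a` (any `q ≥ 1`; `q = 1` is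
vacuous) is transported to `θ` (`Φ` is saturated). [cite: Nesterenko2003, Prop 2.6 (2.9)–(2.13) (pp. 57–58); Matveev2000, (1.3)] -/
theorem exists_step_generators_archW (q : ℕ) (hq : 1 ≤ q) (hr : 0 < r)
    (a : Fin n → ℚ) (ha : ∀ j, 0 < a j)
    (hind : ∀ μ : Fin n → ℤ, ∏ j, a j ^ μ j = 1 → μ = 0)
    (hK : ∀ φ : Fin n → ℤ, (∃ γ : ℚ, ∏ j, a j ^ φ j = γ ^ q) → ∀ j, (q : ℤ) ∣ φ j)
    (A : Fin n → ℝ) (hA : ∀ j, Height.logHeight₁ (a j) ≤ A j) (hA1 : ∀ j, 1 ≤ A j)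
    (b : Fin n → ℤ) (k₀ : Fin n) (hk₀ : b k₀ ≠ 0)
    (H : ConnAlgSubgroup n) (M : Fin r → Fin n → ℤ) (hM : LinearIndependent ℤ M)
    (hchars : H.chars = AddSubgroup.closure (Set.range M))
    (hbM : (fun k => (b k : ℚ)) ∈ Submodule.span ℚ (Set.range fun i => fun k => (M i k : ℚ))) :
    ∃ (Z : Fin r → Fin n → ℤ) (κ κ' : Fin r → Fin n) (θ : Fin r → ℚ) (A' : Fin r → ℝ)
      (m : Fin r → ℤ) (m₀ : ℤ) (i₀ : Fin r),
      (∀ i, θ i = ∏ j, a j ^ Z i j) ∧ (∀ i, A' i = ∑ j, A j * |(Z i j : ℝ)|) ∧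
      LinearIndependent ℤ Z ∧ Submodule.span ℤ (Set.range Z) = Submodule.span ℤ (Set.range M) ∧
      (∀ i, 0 < θ i) ∧
      (∀ μ : Fin r → ℤ, ∏ i, θ i ^ μ i = 1 → μ = 0) ∧
      (∀ c : Fin r → ℤ, (∃ γ : ℚ, ∏ i, θ i ^ c i = γ ^ q) → ∀ i, (q : ℤ) ∣ c i) ∧
      (∀ i, Height.logHeight₁ (θ i) ≤ A' i) ∧ (∀ i, 1 ≤ A' i) ∧
      m i₀ ≠ 0 ∧ Z i₀ k₀ ≠ 0 ∧ m₀ ≠ 0 ∧ ∏ i, θ i ^ m i = (∏ j, a j ^ b j) ^ m₀ ∧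
      Function.Injective κ ∧ (Matrix.of fun i j => (M j (κ i) : ℝ)).det ≠ 0 ∧
      (∀ κ₁ : Fin r → Fin n,
        |(Matrix.of fun i j => (M j (κ₁ i) : ℝ)).det| * ∏ i, A (κ₁ i) ≤
          |(Matrix.of fun i j => (M j (κ i) : ℝ)).det| * ∏ i, A (κ i)) ∧
      ∏ i, A' i ≤ ((r.factorial : ℝ)) ^ 2 * (n : ℝ) ^ r *
          (|(Matrix.of fun i j => (M j (κ i) : ℝ)).det| * ∏ i, A (κ i)) ∧
      Function.Injective κ' ∧ (∃ i, κ' i = k₀) ∧ (|m₀| : ℝ) * ∏ i, A (κ' i) ≤ ∏ i, A' i ∧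
      (∀ j, (|m j| : ℝ) * ∏ i, A (κ' i) ≤
        (∑ i, A (κ' i) * |(b (κ' i) : ℝ)|) * ∏ i ∈ univ.erase j, A' i) := by
  classical
  have ha0 : ∀ j, a j ≠ 0 := fun j => (ha j).ne'
  have hA0 : ∀ j, 0 < A j := fun j => by linarith [hA1 j]
  obtain ⟨Z, κ, m₀', mm', κ'', hZli, hZspan, hκ, hdet, hmax, hprod, -, hm₀', hrel', -, -, hθK⟩ :=
    Summit.ABC.StewartYu.MatveevStepData.exists_matveev_step_data (K := ℚ) q hq hr hA0 a ha0
      hind hK H M hM hchars b hbM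
  clear κ''
  set θ : Fin r → ℚ := fun i => ∏ j, a j ^ Z i j with hθdef
  set A' : Fin r → ℝ := fun i => ∑ j, A j * |(Z i j : ℝ)| with hA'def
  have hθ : ∀ i, θ i = ∏ j, a j ^ Z i j := fun i => rfl
  obtain ⟨hindθ, hKθ⟩ := hθK θ hθ
  have hZne : ∀ i, Z i ≠ 0 := fun i => hZli.ne_zero i
  -- `b ∈ span_ℚ Z` from the (discarded) relation `m₀′ b = ∑ mm′ᵢ Zᵢ`
  have hbZ : (fun k => (b k : ℚ)) ∈ Submodule.span ℚ (Set.range fun i => fun k => (Z i k : ℚ)) := by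
    rw [Submodule.mem_span_range_iff_exists_fun]
    refine ⟨fun i => (mm' i : ℚ) / m₀', ?_⟩
    funext k
    have h1 := hrel' k
    have hm₀q : (m₀' : ℚ) ≠ 0 := by exact_mod_cast hm₀'
    simp only [Finset.sum_apply, Pi.smul_apply, smul_eq_mul]
    have h2 : ((m₀' * b k : ℤ) : ℚ) = ((∑ i, mm' i * Z i k : ℤ) : ℚ) := by rw [h1]
    push_cast at h2
    calc ∑ i, (mm' i : ℚ) / (m₀' : ℚ) * (Z i k : ℚ) = (∑ i, (mm' i : ℚ) * (Z i k : ℚ)) / (m₀' : ℚ) := by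
          rw [Finset.sum_div]
          exact Finset.sum_congr rfl fun i _ => by ring
      _ = ((m₀' : ℚ) * (b k : ℚ)) / (m₀' : ℚ) := by rw [h2]
      _ = (b k : ℚ) := by field_simp
  -- column `k₀` of `Z` is non-zero
  have hcol : ∃ i, Z i k₀ ≠ 0 := by
    by_contra h0
    push Not at h0
    have h1 := hrel' k₀
    have h2 : ∑ i, mm' i * Z i k₀ = 0 := Finset.sum_eq_zero fun i _ => by rw [h0 i, mul_zero]
    rw [h2, mul_eq_zero] at h1
    rcases h1 with h1 | h1
    · exact hm₀' h1
    · exact hk₀ h1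
  -- a Cramer minor through `k₀`, and the relation on it
  obtain ⟨κ', hκ', hk₀mem, hdet'⟩ := exists_minor_through Z hZli k₀ hcol
  obtain ⟨m₀, m, hm₀, hrel, hm₀le, hmle⟩ := exists_int_relation_weighted_of_minor hA0 Z b hbZ κ' hκ' hdet'
  -- the relation `∏ θ^m = (∏ a^b)^{m₀}`
  have hrelθ : ∏ i, θ i ^ m i = (∏ j, a j ^ b j) ^ m₀ := by
    rw [Summit.ABC.StewartYu.KummerBasisChange.prod_zpow_basisChange a ha0 Z θ hθ m, ← Finset.prod_zpow]
    refine Finset.prod_congr rfl fun j _ => ?_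
    rw [← zpow_mul, mul_comm (b j) m₀, hrel j]
  -- the new pivot
  obtain ⟨i₀, hi₀⟩ : ∃ i, m i * Z i k₀ ≠ 0 := by
    by_contra h0
    push Not at h0
    have h1 := hrel k₀
    rw [Finset.sum_eq_zero fun i _ => h0 i, mul_eq_zero] at h1
    rcases h1 with h1 | h1
    · exact hm₀ h1
    · exact hk₀ h1
  refine ⟨Z, κ, κ', θ, A', m, m₀, i₀, hθ, fun i => rfl, hZli, hZspan, ?_, hindθ, hKθ, ?_, ?_,
    left_ne_zero_of_mul hi₀, right_ne_zero_of_mul hi₀, hm₀, hrelθ, hκ, hdet, hmax, hprod, hκ', hk₀mem,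
    hm₀le, hmle⟩
  · intro i
    exact prod_zpow_pos a ha (Z i)
  · intro i
    exact logHeight₁_prod_zpow_le a A hA (Z i)
  · intro i
    exact one_le_weightedNorm A hA1 (Z i) (hZne i)

/-! ### The numeric core of the step: the new bound `B′` and the cost line -/

/-- **The numeric heart of the pivot-weighted Matveev step** (shared by the Kummer-free and the Kummer-carrying
steps): from the Cramer–Hadamard bounds on a minor `κ′` THROUGH the pivot (`A_{k₀} ≤ ∏A_{κ′}`), the new pivot
`i₀` (`A_{k₀} ≤ A′_{i₀}`), `∏A′ ≤ P`, the covolume clause `P·Y ≤ Ω`, the regime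
`C(n)·Ω·log(eB) < ∑Aⱼ|bⱼ| + log 2` and the numeric lines `r(n+1) ≤ Y·C(n)`, `2C(r) + Y ≤ Y·C(n)`:
the bound `B′ := r·B·∏A′/A′_{i₀}` satisfies `|mⱼ|A′ⱼ ≤ B′·A′_{i₀}` and the cost line
`C(r)·∏A′·log(eB′) + log|m₀| ≤ C(n)·Ω·log(eB)` (on the way: `B′ < B²`, `|m₀| < B`).
[cite: Nesterenko2003, Prop 2.6 (2.11)–(2.13) (p. 58); Matveev2000, (1.3)] -/
theorem exists_bound_and_cost {C : ℕ → ℝ} (hr : 0 < r) (hCr : 0 ≤ C r)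
    {A : Fin n → ℝ} (hA1 : ∀ j, 1 ≤ A j) {b : Fin n → ℤ} {B : ℝ} {k₀ : Fin n} (hk₀ : b k₀ ≠ 0)
    (hBw : ∀ j, (|b j| : ℝ) * A j ≤ B * A k₀)
    {A' : Fin r → ℝ} (hA1' : ∀ i, 1 ≤ A' i) {i₀ : Fin r} (hA'i₀ : A k₀ ≤ A' i₀)
    {m : Fin r → ℤ} {m₀ : ℤ} (hm₀ : m₀ ≠ 0)
    {κ' : Fin r → Fin n} (hκ'prod : A k₀ ≤ ∏ i, A (κ' i))
    (hm₀le : (|m₀| : ℝ) * ∏ i, A (κ' i) ≤ ∏ i, A' i)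
    (hmle : ∀ j, (|m j| : ℝ) * ∏ i, A (κ' i) ≤
      (∑ i, A (κ' i) * |(b (κ' i) : ℝ)|) * ∏ i ∈ univ.erase j, A' i)
    {P : ℝ} (hprod : ∏ i, A' i ≤ P)
    (hreg : C n * (∏ j, A j) * Real.log (Real.exp 1 * B) < ∑ j, A j * |(b j : ℝ)| + Real.log 2)
    {Y : ℝ} (hY : 0 < Y) (hYC1 : (r : ℝ) * (n + 1) ≤ Y * C n) (hYC2 : 2 * C r + Y ≤ Y * C n)
    (hPcov : P * Y ≤ ∏ j, A j) :
    ∃ B' : ℝ, (∀ j, (|m j| : ℝ) * A' j ≤ B' * A' i₀) ∧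
      C r * (∏ i, A' i) * Real.log (Real.exp 1 * B') + Real.log |(m₀ : ℝ)| ≤
        C n * (∏ j, A j) * Real.log (Real.exp 1 * B) := by
  classical
  set PA : ℝ := ∏ i, A' i with hPAdef
  set Om : ℝ := ∏ j, A j with hOmdef
  set L : ℝ := Real.log (Real.exp 1 * B) with hLdef
  -- positivity / floors
  have hr1 : (1 : ℝ) ≤ r := by exact_mod_cast hr
  have hn0 : (0 : ℝ) < (n : ℝ) + 1 := by positivity
  have hB1 : 1 ≤ B := one_le_boundW hA1 hk₀ hBw
  have hB0 : 0 < B := by linarith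
  have hA'0 : ∀ i, 0 < A' i := fun i => by linarith [hA1' i]
  have hPA1 : 1 ≤ PA := Finset.one_le_prod fun i _ => hA1' i
  have hPA0 : 0 < PA := by linarith
  have hOm1 : 1 ≤ Om := Finset.one_le_prod fun j _ => hA1 j
  have hAk₀ : 1 ≤ A k₀ := hA1 k₀
  have hAk₀0 : 0 < A k₀ := by linarith
  have hBA : 1 ≤ B * A k₀ := one_le_mul_of_one_le_of_one_le hB1 hAk₀
  have hL1 : 1 ≤ L := one_le_log_exp_one_mul hB1
  have hL0 : 0 < L := by linarith
  have hrn1 : (0 : ℝ) < (r : ℝ) * (n + 1) := by positivity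
  have hCn0 : 0 < C n := pos_of_mul_pos_right (hrn1.trans_le hYC1) hY.le
  have hPAP : PA ≤ P := hprod
  have hP0 : 0 ≤ P := hPA0.le.trans hPAP
  have he1 : 1 ≤ Real.exp 1 := by have := Real.add_one_le_exp (1 : ℝ); linarith
  have he0 : 0 < Real.exp 1 := Real.exp_pos 1
  have hκ'prod0 : 0 < ∏ i, A (κ' i) := by linarith
  -- `|m₀|·A_{k₀} ≤ ∏A′`
  have hm₀Q : |(m₀ : ℝ)| * A k₀ ≤ PA :=
    (mul_le_mul_of_nonneg_left hκ'prod (abs_nonneg _)).trans hm₀le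
  -- `∑_{κ′} A|b| ≤ r·B·A_{k₀}`
  have hS : ∑ i, A (κ' i) * |(b (κ' i) : ℝ)| ≤ (r : ℝ) * (B * A k₀) := by
    calc ∑ i, A (κ' i) * |(b (κ' i) : ℝ)| = ∑ i, (|(b (κ' i) : ℝ)|) * A (κ' i) :=
          Finset.sum_congr rfl fun i _ => mul_comm _ _
      _ ≤ ∑ _i : Fin r, B * A k₀ := Finset.sum_le_sum fun i _ => hBw _
      _ = (r : ℝ) * (B * A k₀) := by
          rw [Finset.sum_const, Finset.card_univ, Fintype.card_fin, nsmul_eq_mul]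
  -- `|mⱼ|·A′ⱼ ≤ r·B·∏A′`
  have hmj : ∀ j, |(m j : ℝ)| * A' j ≤ (r : ℝ) * B * PA := by
    intro j
    have h1 := hmle j
    have h3 : (∏ i ∈ univ.erase j, A' i) * A' j = PA := Finset.prod_erase_mul _ _ (Finset.mem_univ j)
    have h2 : |(m j : ℝ)| * A' j * ∏ i, A (κ' i) ≤ (r : ℝ) * (B * A k₀) * PA :=
      calc |(m j : ℝ)| * A' j * ∏ i, A (κ' i) = (|(m j : ℝ)| * ∏ i, A (κ' i)) * A' j := by ring
        _ ≤ ((∑ i, A (κ' i) * |(b (κ' i) : ℝ)|) * ∏ i ∈ univ.erase j, A' i) * A' j :=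
            mul_le_mul_of_nonneg_right h1 (hA'0 j).le
        _ = (∑ i, A (κ' i) * |(b (κ' i) : ℝ)|) * PA := by rw [mul_assoc, h3]
        _ ≤ (r : ℝ) * (B * A k₀) * PA := mul_le_mul_of_nonneg_right hS hPA0.le
    have h4 : |(m j : ℝ)| * A' j * A k₀ ≤ |(m j : ℝ)| * A' j * ∏ i, A (κ' i) :=
      mul_le_mul_of_nonneg_left hκ'prod (mul_nonneg (abs_nonneg _) (hA'0 j).le)
    have h5 : |(m j : ℝ)| * A' j * A k₀ ≤ ((r : ℝ) * B * PA) * A k₀ :=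
      calc |(m j : ℝ)| * A' j * A k₀ ≤ (r : ℝ) * (B * A k₀) * PA := h4.trans h2
        _ = ((r : ℝ) * B * PA) * A k₀ := by ring
    exact le_of_mul_le_mul_right h5 hAk₀0
  -- the new bound `B′ := r·B·∏A′/A′_{i₀}`
  set B' : ℝ := (r : ℝ) * B * PA / A' i₀ with hB'def
  have hB'mul : B' * A' i₀ = (r : ℝ) * B * PA := by
    rw [hB'def]; exact div_mul_cancel₀ _ (hA'0 i₀).ne'
  have hB'w : ∀ j, |(m j : ℝ)| * A' j ≤ B' * A' i₀ := fun j => by rw [hB'mul]; exact hmj j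
  -- the regime: `C n·Ω·L < (n+1)·B·A_{k₀}`
  have hreg' : C n * Om * L < ((n : ℝ) + 1) * (B * A k₀) := by
    have h1 : ∑ j, A j * |(b j : ℝ)| ≤ n * B * A k₀ := sum_weight_abs_le_W hBw
    have h2 : Real.log 2 < B * A k₀ := by
      have := Real.log_two_lt_d9; linarith
    have h3 : (n : ℝ) * B * A k₀ + B * A k₀ = ((n : ℝ) + 1) * (B * A k₀) := by ring
    linarith
  -- `r·P < B·A_{k₀}`
  have hPB : (r : ℝ) * P < B * A k₀ := by
    have h1 : P * Y * C n ≤ Om * C n := mul_le_mul_of_nonneg_right hPcov hCn0.le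
    have h2 : Om * C n ≤ Om * C n * L :=
      le_mul_of_one_le_right (mul_nonneg (by linarith) hCn0.le) hL1
    have e2 : C n * Om * L = Om * C n * L := by ring
    have h3 : P * Y * C n < ((n : ℝ) + 1) * (B * A k₀) := by linarith [hreg']
    have h4 : P * ((r : ℝ) * (n + 1)) ≤ P * (Y * C n) := mul_le_mul_of_nonneg_left hYC1 hP0
    have h5 : ((n : ℝ) + 1) * ((r : ℝ) * P) < ((n : ℝ) + 1) * (B * A k₀) := by
      have e5 : ((n : ℝ) + 1) * ((r : ℝ) * P) = P * ((r : ℝ) * (n + 1)) := by ring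
      have e6 : P * (Y * C n) = P * Y * C n := by ring
      linarith
    exact lt_of_mul_lt_mul_left h5 hn0.le
  -- `B′ < B²`, `1 ≤ B′`, `|m₀| < B`
  have hrB0 : 0 ≤ (r : ℝ) * B := mul_nonneg (Nat.cast_nonneg r) hB0.le
  have hB'lt : B' < B * B := by
    have h1 : B' ≤ (r : ℝ) * B * P / A k₀ := by
      calc B' = (r : ℝ) * B * PA / A' i₀ := hB'def
        _ ≤ (r : ℝ) * B * PA / A k₀ :=
            div_le_div_of_nonneg_left (mul_nonneg hrB0 hPA0.le) hAk₀0 hA'i₀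
        _ ≤ (r : ℝ) * B * P / A k₀ :=
            div_le_div_of_nonneg_right (mul_le_mul_of_nonneg_left hPAP hrB0) hAk₀0.le
    have h2 : (r : ℝ) * B * P / A k₀ < B * B := by
      rw [div_lt_iff₀ hAk₀0]
      have h3 : B * ((r : ℝ) * P) < B * (B * A k₀) := mul_lt_mul_of_pos_left hPB hB0
      have e3 : (r : ℝ) * B * P = B * ((r : ℝ) * P) := by ring
      have e4 : B * B * A k₀ = B * (B * A k₀) := by ring
      rw [e3, e4]; exact h3
    exact h1.trans_lt h2
  have hB'1 : 1 ≤ B' := by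
    rw [hB'def, le_div_iff₀ (hA'0 i₀), one_mul]
    have h1 : A' i₀ ≤ PA := le_prod_of_one_le hA1' i₀
    have h2 : PA ≤ (r : ℝ) * B * PA :=
      le_mul_of_one_le_left hPA0.le (one_le_mul_of_one_le_of_one_le hr1 hB1)
    exact h1.trans h2
  have hm₀B : |(m₀ : ℝ)| < B := by
    have h1 : |(m₀ : ℝ)| * A k₀ ≤ P := hm₀Q.trans hPAP
    have h2 : P ≤ (r : ℝ) * P := le_mul_of_one_le_left hP0 hr1
    have h3 : |(m₀ : ℝ)| * A k₀ < B * A k₀ := by linarith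
    exact lt_of_mul_lt_mul_right h3 hAk₀0.le
  -- logarithms
  have hm₀pos : (0 : ℝ) < |(m₀ : ℝ)| := abs_pos.mpr (by exact_mod_cast hm₀)
  have hBe : B ≤ Real.exp 1 * B := le_mul_of_one_le_left hB0.le he1
  have hlogm₀ : Real.log |(m₀ : ℝ)| ≤ L := by
    have h1 : |(m₀ : ℝ)| ≤ Real.exp 1 * B := by linarith
    exact Real.log_le_log hm₀pos h1
  have hlogB' : Real.log (Real.exp 1 * B') ≤ 2 * L := by
    have h0 : 0 < Real.exp 1 * B' := mul_pos he0 (by linarith)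
    have h1 : Real.exp 1 * B' < Real.exp 1 * (B * B) := mul_lt_mul_of_pos_left hB'lt he0
    have h2 : Real.exp 1 * (B * B) ≤ (Real.exp 1 * B) * (Real.exp 1 * B) := by
      have h3 : Real.exp 1 * (B * B) = (Real.exp 1 * B) * B := by ring
      rw [h3]
      exact mul_le_mul_of_nonneg_left hBe (mul_nonneg he0.le hB0.le)
    have h4 := Real.log_le_log h0 (h1.le.trans h2)
    rw [Real.log_mul (mul_pos he0 hB0).ne' (mul_pos he0 hB0).ne'] at h4
    rw [hLdef]; linarith
  have hlogB'0 : 0 ≤ Real.log (Real.exp 1 * B') := zero_le_one.trans (one_le_log_exp_one_mul hB'1)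
  -- the cost line
  refine ⟨B', hB'w, ?_⟩
  have h1 : C r * PA * Real.log (Real.exp 1 * B') ≤ C r * P * (2 * L) :=
    mul_le_mul (mul_le_mul_of_nonneg_left hPAP hCr) hlogB' hlogB'0 (mul_nonneg hCr hP0)
  have h2 : C r * P * (2 * L) * Y ≤ 2 * C r * Om * L := by
    have h0 : 0 ≤ 2 * C r * L := by positivity
    have := mul_le_mul_of_nonneg_left hPcov h0
    have e1 : C r * P * (2 * L) * Y = 2 * C r * L * (P * Y) := by ring
    have e2 : 2 * C r * Om * L = 2 * C r * L * Om := by ring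
    rw [e1, e2]; exact this
  have h3 : Real.log |(m₀ : ℝ)| ≤ Om * L := hlogm₀.trans (le_mul_of_one_le_left hL0.le hOm1)
  have h5 : (2 * C r + Y) * (Om * L) ≤ Y * C n * (Om * L) :=
    mul_le_mul_of_nonneg_right hYC2 (mul_nonneg (by linarith) hL0.le)
  have h4 : (C r * P * (2 * L) + Om * L) * Y ≤ C n * Om * L * Y := by
    have e3 : (C r * P * (2 * L) + Om * L) * Y = C r * P * (2 * L) * Y + Y * (Om * L) := by ring
    have e4 : (2 * C r + Y) * (Om * L) = 2 * C r * Om * L + Y * (Om * L) := by ring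
    have e5 : Y * C n * (Om * L) = C n * Om * L * Y := by ring
    rw [e3]; rw [e4, e5] at h5; linarith
  have h6 : C r * P * (2 * L) + Om * L ≤ C n * Om * L := le_of_mul_le_mul_right h4 hY
  linarith

/-! ### The step, closed against the regime and a numeric record clause -/

/-- **The Matveev step at the archimedean place in the pivot-weighted currency, closed against the working regime
(2.6) and ONE NUMERIC record clause.**  Inputs: `0 < r < n`, `0 ≤ C r`; the rank-`n` datum of `CoreArchW` with
pivot `k₀`; the exit-C datum; the regime `C(n)·Ω·log(eB) < ∑ Aⱼ|bⱼ| + log 2` (from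
`GenThreeBaseArch.regime_of_not_le`); and, for a slack `Y > 0` of the record's choosing, the covolume clause
`P(κ)·Y ≤ Ω` for the maximal non-singular weighted minor (`P(κ) = (r!)²nʳ·|det M_κ|·∏A_κ`) together with the
purely numeric `r·(n+1) ≤ Y·C(n)` and `2·C(r) + Y ≤ Y·C(n)`.  Output: `StepArchW C n a b A B`
(choices `B′ := r·B·∏A′/A′_{i₀} < B²`, `D := log|m₀| < log B`).
[cite: Nesterenko2003, Prop 2.6 (2.11)–(2.13) (p. 58), §5.2 (5.21)–(5.22) (pp. 105–106); Matveev2000, (1.3)] -/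
theorem stepArchW_of_exitC {C : ℕ → ℝ} (hr : 0 < r) (hrn : r < n) (hCr : 0 ≤ C r)
    (a : Fin n → ℚ) (ha : ∀ j, 0 < a j)
    (hind : ∀ μ : Fin n → ℤ, ∏ j, a j ^ μ j = 1 → μ = 0)
    (A : Fin n → ℝ) (hA : ∀ j, Height.logHeight₁ (a j) ≤ A j) (hA1 : ∀ j, 1 ≤ A j)
    (b : Fin n → ℤ) {B : ℝ} (k₀ : Fin n) (hk₀ : b k₀ ≠ 0) (hBw : ∀ j, (|b j| : ℝ) * A j ≤ B * A k₀)
    (H : ConnAlgSubgroup n) (M : Fin r → Fin n → ℤ) (hM : LinearIndependent ℤ M)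
    (hchars : H.chars = AddSubgroup.closure (Set.range M))
    (hbM : (fun k => (b k : ℚ)) ∈ Submodule.span ℚ (Set.range fun i => fun k => (M i k : ℚ)))
    (hreg : C n * (∏ j, A j) * Real.log (Real.exp 1 * B) < ∑ j, A j * |(b j : ℝ)| + Real.log 2)
    {Y : ℝ} (hY : 0 < Y) (hYC1 : (r : ℝ) * (n + 1) ≤ Y * C n) (hYC2 : 2 * C r + Y ≤ Y * C n)
    (hcov : ∀ κ : Fin r → Fin n, Function.Injective κ →
      (Matrix.of fun i j => (M j (κ i) : ℝ)).det ≠ 0 →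
      ((r.factorial : ℝ)) ^ 2 * (n : ℝ) ^ r *
          (|(Matrix.of fun i j => (M j (κ i) : ℝ)).det| * ∏ i, A (κ i)) * Y ≤ ∏ j, A j) :
    StepArchW C n a b A B := by
  classical
  -- the trivial Kummer condition at exponent `q = 1`
  have hK1 : ∀ φ : Fin n → ℤ, (∃ γ : ℚ, ∏ j, a j ^ φ j = γ ^ 1) → ∀ j, ((1 : ℕ) : ℤ) ∣ φ j :=
    fun φ _ j => by simp
  obtain ⟨Z, κ, κ', θ, A', m, m₀, i₀, hθ, hA', _hZli, _hZspan, hθpos, hindθ, -, hhA', hA1', hmi₀, hZi₀,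
    hm₀, hrel, hκ, hdet, _hmax, hprod, hκ', ⟨i₁, hi₁⟩, hm₀le, hmle⟩ :=
    exists_step_generators_archW 1 le_rfl hr a ha hind hK1 A hA hA1 b k₀ hk₀ H M hM hchars hbM
  -- `∏ A_κ′ ≥ A_{k₀}` (the minor passes through `k₀`) and `A′_{i₀} ≥ A_{k₀}`
  have hκ'prod : A k₀ ≤ ∏ i, A (κ' i) := by
    rw [← hi₁]; exact le_prod_of_one_le (fun i => hA1 _) i₁
  have hA'i₀ : A k₀ ≤ A' i₀ := by
    rw [hA' i₀]
    have h1 : A k₀ * |(Z i₀ k₀ : ℝ)| ≤ ∑ j, A j * |(Z i₀ j : ℝ)| :=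
      Finset.single_le_sum (f := fun j => A j * |(Z i₀ j : ℝ)|)
        (fun j _ => mul_nonneg (by linarith [hA1 j]) (abs_nonneg _)) (Finset.mem_univ k₀)
    have h2 : (1 : ℝ) ≤ |(Z i₀ k₀ : ℝ)| := by exact_mod_cast Int.one_le_abs hZi₀
    exact (le_mul_of_one_le_right (by linarith [hA1 k₀]) h2).trans h1
  obtain ⟨B', hB'w, hcost⟩ := exists_bound_and_cost hr hCr hA1 hk₀ hBw hA1' hA'i₀ hm₀ hκ'prod hm₀le
    hmle hprod hreg hY hYC1 hYC2 (hcov κ hκ hdet)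
  exact stepArchW_of_pow_eq ha hrn θ m A' B' i₀ hθpos hindθ hhA' hA1' hmi₀ hB'w m₀ hm₀ hrel hcost

end Summit.ABC.StewartYu.GenThreeStepArchW

end
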